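import Summits.AtomisticToContinuum.Crystallization.Cruxes.MinimiserShells.Lines.defect_exchange_two_resolutions

/-!
# Line `defect-exchange-two-resolutions` (crux `MinimiserShells`, stmt-AtomisticToContinuum-9225):
the typed certificates (D), (S) have the DEGENERATE solution `t = 0` exactly when the class has no awful site

Lead prover-line-stmt-AtomisticToContinuum-9225-c11-0, 2026-08-17 (evidence for `Lines/defect-exchange-two-resolutions-dead.md`).

`DensePricing c t` and `SparseSolvent c t` (skeleton `Lines/defect_exchange_two_resolutions.lean`) quantify only over
`InClass S` — rooted, `17/20`-separated Sütő `e*`-μGSCs of Lennard-Jones, i.e. over GROUND STATES.  If no configuration of the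
class has an awful (not `(a/20)`-good) site, then for EVERY margin `c` both certificates hold with the ZERO transfer
(`certificates_of_forall_awfulSet_eq_empty`), hence the registered stubs `stub_denseSolvency` / `stub_sparseSolvency` hold
(`denseSolvency_and_sparseSolvency_of_forall_awfulSet_eq_empty`).  So the certificate format is implied by deterministic coarse
crystallization of LJ ground states on the class (its `t = 0` solution), while the skeleton's composition shows that together
with S1/S4 it implies the measure-level coarse statement: the stubs carry exactly coarse-crux content, in certificate clothing.
-/

noncomputable section

open MeasureTheory

namespace Summit.AtomisticToContinuum.Crystallization.Cruxes.MinimiserShells.DefectExchangeTwoResolutions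

open Literature.MathematicalPhysics.StatisticalMechanics (UniformlyDiscrete)

/-- The zero transfer is admissible. -/
theorem isTransfer_zero : IsTransfer (fun _ _ => (0 : ℝ)) :=
  ⟨measurable_const, fun _ _ => le_rfl, ⟨0, fun _ _ => le_rfl⟩, ⟨0, fun _ _ _ => rfl⟩⟩

/-- On the class, a configuration with no awful site is nowhere dense-type at the root: the root's `4`-ball contains the
root and is finite (hard core `17/20`), while its awful part is empty. -/
theorem not_isDense_of_awfulSet_eq_empty {S : Set E3} (hS : InClass S) (h : awfulSet S = ∅) : ¬ IsDense S 0 := by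
  have hud : UniformlyDiscrete S := ⟨17 / 20, by norm_num, hS.2.1⟩
  have hfin : (S ∩ Metric.closedBall (0 : E3) 4).Finite := hud.finite_inter_closedBall 0 4
  have hmem : (0 : E3) ∈ S ∩ Metric.closedBall (0 : E3) 4 :=
    ⟨hS.1, Metric.mem_closedBall_self (by norm_num)⟩
  have hpos : 0 < (S ∩ Metric.closedBall (0 : E3) 4).ncard := (Set.ncard_pos hfin).2 ⟨0, hmem⟩
  unfold IsDense
  rw [h, Set.empty_inter, Set.ncard_empty]
  push_cast
  intro hle
  have : (1 : ℝ) ≤ (S ∩ Metric.closedBall (0 : E3) 4).ncard := by exact_mod_cast hpos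
  linarith

/-- **Degenerate certificates.**  If no configuration of the class has an awful site, then for every margin `c` the dense
certificate (D) and the sparse certificate (S) both hold with the zero transfer. -/
theorem certificates_of_forall_awfulSet_eq_empty (h : ∀ S : Set E3, InClass S → awfulSet S = ∅) (c : ℝ) :
    DensePricing c (fun _ _ => 0) ∧ SparseSolvent c (fun _ _ => 0) := by
  constructor
  · intro S hS
    have hnd := not_isDense_of_awfulSet_eq_empty hS (h S hS)
    have hna : (0 : E3) ∉ awfulSet S := by rw [h S hS]; exact Set.notMem_empty _
    exact ⟨fun ha _ => absurd ha hna, fun _ hd => absurd hd hnd, fun ha _ => absurd ha hna, fun _ _ _ => rfl⟩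
  · constructor
    · intro S _ _ _; rfl
    · intro S hS ha _
      have hna : (0 : E3) ∉ awfulSet S := by rw [h S hS]; exact Set.notMem_empty _
      exact absurd ha hna

/-- **Hence the registered stubs S2 and S3 follow from "no awful site on the class"** (deterministic coarse crystallization of
Lennard-Jones ground states): both existentials are witnessed by any `c > 0` and `t = 0`. -/
theorem denseSolvency_and_sparseSolvency_of_forall_awfulSet_eq_empty
    (h : ∀ S : Set E3, InClass S → awfulSet S = ∅) :
    (∃ c : ℝ, 0 < c ∧ ∃ t : Measure E3 → E3 → ℝ, IsTransfer t ∧ DensePricing c t) ∧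
    (∃ c : ℝ, 0 < c ∧ ∃ t : Measure E3 → E3 → ℝ, IsTransfer t ∧ SparseSolvent c t) :=
  ⟨⟨1, one_pos, _, isTransfer_zero, (certificates_of_forall_awfulSet_eq_empty h 1).1⟩,
   ⟨1, one_pos, _, isTransfer_zero, (certificates_of_forall_awfulSet_eq_empty h 1).2⟩⟩

end Summit.AtomisticToContinuum.Crystallization.Cruxes.MinimiserShells.DefectExchangeTwoResolutions

end
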